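import Literature.MathematicalPhysics.QuantumFieldTheory.Balaban1983to89.B12Rep526Coeff
import Literature.Analysis.FunctionSpaces.LatticeParseval

/-!
# `Balaban1983to89.B12Rep526Unique` — [Balaban1987RG1] §5 pp. 294–295: UNIQUENESS of the representation (5.26)
in `d` variables and the printed equivalences «(5.18) ⇔ (5.27)», «(5.20) ⇔ (5.28)» for an arbitrary (5.26)-pair

HONEST FRAMING (cell `lit-balaban`, verbatim): statement-level skeleton of published theorems with citation tags;
proofs where landed; nothing here is a claim about the Yang–Mills mass gap.

CITATION HEADER.  T. Bałaban, *Renormalization group approach to lattice gauge field theories. I. Generation of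
effective actions in a small field approximation and a coupling constant renormalization in four dimensions*,
Commun. Math. Phys. **109** (1987) 249–301, doi:10.1007/bf01215223 [Balaban1987RG1] (cell paper B12).
PDF held: `paper:balaban1987-cmp109-rg-i-small-field` (journal page = PDF page + 248; displays read as images from the
page renders `b2b-balaban-ref1/pages/1987-cmp109-rg-I-small-field/…-p046-x2.png` (p. 294), `…-p047-x2.png` (p. 295)).
Unit `lit-balaban-r09` gen 3, HOME `run/shared/lean/pub/lit-balaban/`; WHAT IS REPRODUCED = the residue of SKELETON rows
`B12.Eq5.22-5.26` / `B12.Eq5.27-5.29` named in the headers of `B12Rep526` (r09 g2: «NOT typed here: the converse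
implications «equivalent» (they rest on the UNIQUENESS of the Laurent decomposition (5.22) under the normalizations
(5.23)–(5.24) …)») and `B12Rep526Coeff` (r09 g3: «WHAT IS NOT HERE: the abstract «equivalent» for an ARBITRARY pair
(f, g) related by (5.26) (it needs uniqueness of Laurent coefficients in `d` variables …)»).  Imported BY NAME, nothing
re-declared: `PeriodicGleason.zpowv/genFun` ([43]), `B12Rep526.rep526/twist/permZ/low/sgn/key_mu'/key_nu'/
twist_permZ/twist_twist`, `B12Rep526Coeff.flipPt/shiftPt/rshift/role/zpowv_shiftPt/…`, and the tree's Fourier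
analysis on `T^d`: `Literature.Analysis.FunctionSpaces.Torus.fourierSum/fourierSum_coe_apply/mFourierCoeff_fourierSum`
([Grafakos2014, Prop. 3.2.7]: the coefficients of an absolutely convergent Fourier series are recovered).

WHAT IS PRINTED (verbatim, p. 294 / p. 295).  *«Now, a given function f(z) analytic on the ring {e^{−δ₁} < |z| <
e^{δ₁}} can be represented as f(z) = g⁺(z) + g⁻(z⁻¹), where g⁺(z), g⁻(z) are analytic on the disc {|z| < e^{δ₁}}.
This representation is obtained by taking regular and singular parts of the Laurent expansion. It is unique up to an
additive constant, and it can be made unique requiring some normalization conditions.»* … *«Denoting g_{μν}(z) =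
g^{(+1,…,+1)}_{μν}(z), we get the following representation: f_{μν}(z) = Σ_ε ε_με_ν z_μ^{(1−ε_μ)/2} z_ν^{−(1−ε_ν)/2}
g_{μν}(z^ε). (5.26)  Let us now write properties of the functions g_{μν}(z) equivalent to the properties
(5.18)–(5.20). The equalities (5.18) are equivalent to g_{μν}(rz) = ((r⊗r)g)_{μν}(z) if r is a permutation. (5.27)
The equalities (5.19) are implied by the form of the representation (5.26). The equalities (5.20) are equivalent to
g_{μν}(z) = z_ν⁻¹z_μ g_{νμ}(z). (5.28)»*

HOW IT IS FORMALIZED.  The class of `g`: families of power series `g_{μν}(w) = Σ_n b_{μν}(n) wⁿ` (`genFun (b μ ν)`)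
with `ℓ¹` Taylor coefficients supported in the printed orthant `InOrth μ ν` = {`n ≥ 0` («analytic on the polydisc»),
`n_μ ≥ 1` if `μ ≠ ν` (the normalisation «g⁺(0) = 0» for the index μ, i.e. `z_μ | g_{μν}` — (5.24)/(5.25))}; this is
the class of the paper's `g` (the restricted sums of `B12Rep526Coeff` under (5.10)).
* §1 the unit torus `z = e^{2πiθ}` ⊂ the polyring of (5.17): `torusPt`, `zpowv_torusPt`, and the DICTIONARY
  `genFun_torusPt_eq_fourierSum` (Laurent series on the torus = the tree's absolutely convergent Fourier series) ⇒
  **`eq_of_genFun_torusPt_eq`**: uniqueness of `ℓ¹` Laurent coefficients in `d` variables.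
* §2 the coefficient ASSEMBLY of (5.26) `asm μ ν b (m) = Σ_ε ε_με_ν b(ε(m + s(ε)))` with **`rep526_genFun`**:
  `rep526 g = genFun (asm b)`; the support lemma `InOrth.flip_shift_eq` (inside the orthant the substitution
  `n ↦ ε(n + s(ε))` either leaves the orthant or fixes `n`, with sign `+1`) ⇒ `asm b (n) = k·b(n)`, `k ≥ 1`, on the
  orthant ⇒ **`eq_zero_of_asm_eq_zero`** (injectivity) ⇒ **`rep526_unique`**: `g` is determined by the right member
  of (5.26) on the unit torus.
* §3 the printed equivalences, directions ⇒ (the directions ⇐ are r09's `B12Rep526.eq518_of_eq527` /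
  `eq520_of_eq528`): **`eq527_of_eq518`** and **`eq528_of_eq520`** (coefficient form of (5.27)/(5.28); hypothesis-free
  companions `rep526_perm`, `rep526_swap_inv`).
Everything kernel-checked; no `Prop` fact; axioms standard.  NOT HERE: (5.21) in terms of `g`; the `AnalyticOnNhd`
packaging of «analytic on the polydisc» (represented, as in `B12Rep526Coeff`, by absolutely convergent power series).
-/

namespace Literature.MathematicalPhysics.QuantumFieldTheory.Balaban1983to89.B12Rep526Unique

noncomputable section

open Literature.MathematicalPhysics.QuantumFieldTheory.GawedzkiKupiainen1985.PeriodicGleason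
open Literature.MathematicalPhysics.QuantumFieldTheory.Balaban1983to89.B12Rep526
open Literature.MathematicalPhysics.QuantumFieldTheory.Balaban1983to89.B12Rep526Coeff
open Finset

variable {d : ℕ}

/-! ## §0. Monomial bookkeeping (private) -/

/-- `z^{m+n} = z^m z^n` at points with non-zero coordinates. [folklore] -/
private theorem zpowv_add {w : Fin d → ℂ} (hw : ∀ κ, w κ ≠ 0) (m n : Pt d) :
    zpowv w (m + n) = zpowv w m * zpowv w n := by
  unfold zpowv
  rw [← Finset.prod_mul_distrib]
  exact Finset.prod_congr rfl fun κ _ => by rw [Pi.add_apply, zpow_add₀ (hw κ)]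

/-- A monomial supported on one coordinate: `z^{n e_κ} = z_κ^n`. [folklore] -/
private theorem zpowv_single (w : Fin d → ℂ) (κ₀ : Fin d) (n : ℤ) :
    zpowv w (fun κ => if κ = κ₀ then n else 0) = w κ₀ ^ n := by
  unfold zpowv
  rw [Finset.prod_eq_single κ₀]
  · simp
  · intro κ _ hκ
    simp [hκ]
  · intro h
    exact absurd (Finset.mem_univ _) h

/-- `z^{e_ν − e_μ} = z_ν z_μ⁻¹` at points with non-zero coordinates. [folklore] -/
private theorem zpowv_unitVec_sub {w : Fin d → ℂ} (hw : ∀ κ, w κ ≠ 0) (μ ν : Fin d) :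
    zpowv w (unitVec ν - unitVec μ) = w ν * (w μ)⁻¹ := by
  have h1 : (unitVec ν : Pt d) = fun κ => if κ = ν then (1 : ℤ) else 0 := rfl
  have h2 : (-unitVec μ : Pt d) = fun κ => if κ = μ then (-1 : ℤ) else 0 := by
    funext κ; simp [unitVec]; split_ifs <;> simp
  rw [sub_eq_add_neg, zpowv_add hw, h1, h2, zpowv_single, zpowv_single, zpow_one, zpow_neg_one]

/-! ## §1. The unit torus and the uniqueness of Laurent coefficients ([43] / Fourier series on `T^d`)

On the unit torus `z_κ = e^{2πiθ_κ}` the Laurent series `Σ_m A(m) z^m` of an `ℓ¹` family is the absolutely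
convergent Fourier series `Σ_m A(m) e_m(θ)` of the tree's `Literature.Analysis.FunctionSpaces.Torus.fourierSum`,
whose coefficients are recovered by `Torus.mFourierCoeff_fourierSum` [Grafakos, Prop. 3.2.7]: this is the
«uniqueness of the Laurent expansion» invoked on p. 294 («It is unique up to an additive constant, and it can be
made unique requiring some normalization conditions»), in `d` variables. -/

/-- The point `(e^{2πiθ_κ})_κ` of the unit torus `×_κ{|z_κ| = 1}` (inside the polyring of (5.17)).
[cite: Balaban1987RG1, (5.17) p.294] -/
def torusPt (θ : Fin d → ℝ) : Fin d → ℂ := fun κ => Complex.exp (2 * Real.pi * Complex.I * (θ κ : ℂ))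

/-- Torus points have non-zero coordinates. [cite: Balaban1987RG1, (5.17) p.294] -/
theorem torusPt_ne_zero (θ : Fin d → ℝ) (κ : Fin d) : torusPt θ κ ≠ 0 := Complex.exp_ne_zero _

/-- `(e^{2πiθ})^m = e^{2πi m·θ}`. [cite: Balaban1987RG1, (5.29) p.295] -/
theorem zpowv_torusPt (θ : Fin d → ℝ) (m : Pt d) :
    zpowv (torusPt θ) m = Complex.exp (2 * Real.pi * Complex.I * ∑ i, ((m i : ℝ) : ℂ) * (θ i : ℂ)) := by
  unfold zpowv torusPt
  rw [Finset.mul_sum, Complex.exp_sum]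
  refine Finset.prod_congr rfl fun κ _ => ?_
  rw [← Complex.exp_int_mul]
  congr 1
  push_cast
  ring

/-- `|z^m| = 1` on the unit torus. [cite: Balaban1987RG1, (5.29) p.295] -/
theorem norm_zpowv_torusPt (θ : Fin d → ℝ) (m : Pt d) : ‖zpowv (torusPt θ) m‖ = 1 := by
  rw [zpowv_torusPt]
  have : (2 * Real.pi * Complex.I * ∑ i, ((m i : ℝ) : ℂ) * (θ i : ℂ))
      = ((2 * Real.pi * ∑ i, (m i : ℝ) * θ i : ℝ) : ℂ) * Complex.I := by
    push_cast
    ring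
  rw [this, Complex.norm_exp_ofReal_mul_I]

/-- On the unit torus an `ℓ¹` Laurent family is absolutely summable against the monomials.
[cite: Balaban1987RG1, (5.29) p.295] -/
theorem summable_mul_zpowv_torusPt {A : Pt d → ℂ} (hA : Summable fun m => ‖A m‖) (θ : Fin d → ℝ) :
    Summable fun m => A m * zpowv (torusPt θ) m :=
  Summable.of_norm_bounded hA fun m => by rw [norm_mul, norm_zpowv_torusPt, mul_one]

/-- DICTIONARY: on the unit torus the Laurent series `Σ_m A(m) z^m` (`PeriodicGleason.genFun`) IS the absolutely
convergent Fourier series `Torus.fourierSum A` of the tree, evaluated at `θ mod ℤ^d`. [cite: Balaban1987RG1, (5.29) p.295] -/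
theorem genFun_torusPt_eq_fourierSum {A : Pt d → ℂ} (hA : Summable fun m => ‖A m‖) (θ : Fin d → ℝ) :
    genFun A (torusPt θ)
      = Literature.Analysis.FunctionSpaces.Torus.fourierSum A (fun i => ((θ i : ℝ) : UnitAddCircle)) := by
  rw [Literature.Analysis.FunctionSpaces.Torus.fourierSum_coe_apply hA, genFun]
  exact tsum_congr fun m => by rw [zpowv_torusPt]

/-- **Uniqueness of Laurent coefficients in `d` variables**: two `ℓ¹` families whose Laurent series agree on the unit
torus are equal (Fourier coefficients of an absolutely convergent series on `T^d`,
`Torus.mFourierCoeff_fourierSum`). This is the uniqueness invoked on p. 294. [cite: Balaban1987RG1, (5.22) p.294] -/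
theorem eq_of_genFun_torusPt_eq {A A' : Pt d → ℂ} (hA : Summable fun m => ‖A m‖)
    (hA' : Summable fun m => ‖A' m‖) (h : ∀ θ : Fin d → ℝ, genFun A (torusPt θ) = genFun A' (torusPt θ)) :
    A = A' := by
  have hF : Literature.Analysis.FunctionSpaces.Torus.fourierSum A
      = Literature.Analysis.FunctionSpaces.Torus.fourierSum A' := by
    ext t
    have hθ : ∀ i, ∃ x : ℝ, (x : UnitAddCircle) = t i := fun i => QuotientAddGroup.mk_surjective (t i)
    choose θ hθ using hθ
    have ht : (fun i => ((θ i : ℝ) : UnitAddCircle)) = t := funext hθ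
    rw [← ht, ← genFun_torusPt_eq_fourierSum hA, ← genFun_torusPt_eq_fourierSum hA', h]
  funext k
  rw [← Literature.Analysis.FunctionSpaces.Torus.mFourierCoeff_fourierSum hA k,
    ← Literature.Analysis.FunctionSpaces.Torus.mFourierCoeff_fourierSum hA' k, hF]

/-! ## §2. The coefficient assembly of (5.26) and the UNIQUENESS of `g` in (5.26)

For a candidate `g_{μν}(w) = Σ_n b(n) wⁿ` (a power series), the right member of (5.26) is again a Laurent series,
with the ASSEMBLED coefficients `asm μ ν b (m) = Σ_ε ε_με_ν b(ε(m + s(ε)))` (`rep526_genFun`).  On families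
supported in the printed orthant `{n ≥ 0, n_μ ≥ 1 (μ ≠ ν)}` (= «g analytic on the polydisc» + the
normalisation (5.24) `z_μ | g_{μν}`) the assembly is injective (`eq_zero_of_asm_eq_zero`): together with §1 this
gives the uniqueness of `g` in (5.26) (`rep526_unique`) — the d-variable form of «it can be made unique
requiring some normalization conditions». -/

/-- The printed support condition on the Taylor coefficients of `g_{μν}`: non-negative exponents («analytic on the
polydisc») and `n_μ ≥ 1` for `μ ≠ ν` (the normalisation «g⁺(0) = 0» for the index μ, i.e. `z_μ | g_{μν}`).
[cite: Balaban1987RG1, (5.24) p.294] -/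
def InOrth (μ ν : Fin d) (n : Pt d) : Prop := (∀ κ, 0 ≤ n κ) ∧ (μ ≠ ν → 1 ≤ n μ)

/-- The coefficient assembly of (5.26): the Laurent coefficient of `z^m` in
`Σ_ε ε_με_ν z_μ^{(1−ε_μ)/2} z_ν^{−(1−ε_ν)/2} g_{μν}(z^ε)` for `g_{μν}(w) = Σ_n b(n)wⁿ`. [cite: Balaban1987RG1, (5.26) p.295] -/
def asm (μ ν : Fin d) (b : Pt d → ℂ) (m : Pt d) : ℂ :=
  ∑ ε : Fin d → ℤˣ, sgn (ε μ) * sgn (ε ν) * b (flipPt ε (m + shiftPt μ ν ε))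

/-- `(z^ε)^n = z^{εn}` (at every point). [cite: Balaban1987RG1, (5.26) p.295] -/
theorem zpowv_twist (ε : Fin d → ℤˣ) (z : Fin d → ℂ) (n : Pt d) :
    zpowv (twist ε z) n = zpowv z (flipPt ε n) := by
  unfold zpowv twist
  refine Finset.prod_congr rfl fun κ _ => ?_
  rw [← zpow_mul, flipPt_apply]

/-- The prefactor of (5.26) as a monomial: `z_μ^{(1−ε_μ)/2} z_ν^{−(1−ε_ν)/2} = z^{−s(ε)}` at points with non-zero
coordinates. [cite: Balaban1987RG1, (5.26) p.295] -/
theorem low_mul_low_inv_eq_zpowv {z : Fin d → ℂ} (hz : ∀ κ, z κ ≠ 0) (μ ν : Fin d) (ε : Fin d → ℤˣ) :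
    low (ε μ) (z μ) * (low (ε ν) (z ν))⁻¹ = zpowv z (-shiftPt μ ν ε) := by
  have h := zpowv_shiftPt hz μ ν ε
  have hne : zpowv z (shiftPt μ ν ε) ≠ 0 :=
    Finset.prod_ne_zero_iff.mpr fun κ _ => zpow_ne_zero _ (hz κ)
  have hneg : zpowv z (-shiftPt μ ν ε) = (zpowv z (shiftPt μ ν ε))⁻¹ := by
    unfold zpowv
    rw [← Finset.prod_inv_distrib]
    exact Finset.prod_congr rfl fun κ _ => by rw [Pi.neg_apply, zpow_neg]
  rw [hneg, h, mul_inv, inv_inv, mul_comm]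

/-- The substitution `n = ε(m + s(ε))` of the assembly as a bijection of `ℤ^d`. [cite: Balaban1987RG1, (5.26) p.295] -/
def reindex526 (μ ν : Fin d) (ε : Fin d → ℤˣ) : Pt d ≃ Pt d where
  toFun m := flipPt ε (m + shiftPt μ ν ε)
  invFun n := flipPt ε n - shiftPt μ ν ε
  left_inv m := by simp
  right_inv n := by simp

/-- **The right member of (5.26) for power series `g_{μν}(w) = Σ_n b_{μν}(n) wⁿ` is the Laurent series of the
assembled coefficients**: `rep526 g μ ν z = Σ_m asm(b)(m) z^m`, at every point with non-zero coordinates where the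
re-indexed families converge (on the whole unit torus for `ℓ¹` coefficients, `rep526_genFun_torusPt`).
[cite: Balaban1987RG1, (5.26) p.295] -/
theorem rep526_genFun (b : Fin d → Fin d → Pt d → ℂ) (μ ν : Fin d) {z : Fin d → ℂ} (hz : ∀ κ, z κ ≠ 0)
    (hs : ∀ ε : Fin d → ℤˣ, Summable fun m => b μ ν (flipPt ε (m + shiftPt μ ν ε)) * zpowv z m) :
    rep526 (fun μ ν w => genFun (b μ ν) w) μ ν z = genFun (asm μ ν (b μ ν)) z := by
  have hterm : ∀ ε : Fin d → ℤˣ,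
      sgn (ε μ) * sgn (ε ν) * low (ε μ) (z μ) * (low (ε ν) (z ν))⁻¹ * genFun (b μ ν) (twist ε z)
        = ∑' m, sgn (ε μ) * sgn (ε ν) * (b μ ν (flipPt ε (m + shiftPt μ ν ε)) * zpowv z m) := by
    intro ε
    rw [genFun, ← (reindex526 μ ν ε).tsum_eq, ← tsum_mul_left]
    refine tsum_congr fun m => ?_
    have hre : (reindex526 μ ν ε) m = flipPt ε (m + shiftPt μ ν ε) := rfl
    rw [hre, zpowv_twist, flipPt_flipPt, mul_assoc (sgn (ε μ) * sgn (ε ν)), low_mul_low_inv_eq_zpowv hz,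
      zpowv_add hz]
    have hc : zpowv z (-shiftPt μ ν ε) * zpowv z (shiftPt μ ν ε) = 1 := by
      rw [← zpowv_add hz, neg_add_cancel]
      unfold zpowv
      simp
    linear_combination (sgn (ε μ) * sgn (ε ν)) * (b μ ν (flipPt ε (m + shiftPt μ ν ε)) * zpowv z m) * hc
  unfold rep526
  simp_rw [hterm]
  rw [← Summable.tsum_finsetSum (fun ε _ => (hs ε).mul_left _)]
  unfold genFun asm
  refine tsum_congr fun m => ?_
  rw [Finset.sum_mul]
  exact Finset.sum_congr rfl fun ε _ => by ring

/-- The assembled family of an `ℓ¹` family is `ℓ¹`. [cite: Balaban1987RG1, (5.26) p.295] -/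
theorem summable_norm_asm {b : Pt d → ℂ} (hb : Summable fun n => ‖b n‖) (μ ν : Fin d) :
    Summable fun m => ‖asm μ ν b m‖ := by
  have hε : ∀ ε : Fin d → ℤˣ, Summable fun m => ‖b (flipPt ε (m + shiftPt μ ν ε))‖ :=
    fun ε => (reindex526 μ ν ε).summable_iff.mpr hb
  have hS : Summable fun m => ∑ ε : Fin d → ℤˣ, ‖b (flipPt ε (m + shiftPt μ ν ε))‖ :=
    summable_sum fun ε _ => hε ε
  refine Summable.of_nonneg_of_le (fun _ => norm_nonneg _) (fun m => ?_) hS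
  refine (norm_sum_le _ _).trans (Finset.sum_le_sum fun ε _ => ?_)
  rw [norm_mul, norm_mul]
  have h1 : ‖(sgn (ε μ) : ℂ)‖ = 1 := by rcases Int.units_eq_one_or (ε μ) with h | h <;> simp [sgn, h]
  have h2 : ‖(sgn (ε ν) : ℂ)‖ = 1 := by rcases Int.units_eq_one_or (ε ν) with h | h <;> simp [sgn, h]
  rw [h1, h2, one_mul, one_mul]

/-- (5.26) as a Laurent series on the unit torus, for `ℓ¹` Taylor coefficients. [cite: Balaban1987RG1, (5.26) p.295] -/
theorem rep526_genFun_torusPt (b : Fin d → Fin d → Pt d → ℂ) (μ ν : Fin d)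
    (hb : Summable fun n => ‖b μ ν n‖) (θ : Fin d → ℝ) :
    rep526 (fun μ ν w => genFun (b μ ν) w) μ ν (torusPt θ) = genFun (asm μ ν (b μ ν)) (torusPt θ) :=
  rep526_genFun b μ ν (torusPt_ne_zero θ) fun ε =>
    summable_mul_zpowv_torusPt ((reindex526 μ ν ε).summable_iff.mpr hb) θ

/-- KEY SUPPORT LEMMA: inside the printed orthant the substitution `n ↦ ε(n + s(ε))` either leaves the orthant or
fixes `n` (only generic coordinates with `n_κ = 0` may flip). [cite: Balaban1987RG1, (5.24) p.294] -/
theorem InOrth.flip_shift_eq {μ ν : Fin d} {n : Pt d} (hn : InOrth μ ν n) (ε : Fin d → ℤˣ)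
    (h : InOrth μ ν (flipPt ε (n + shiftPt μ ν ε))) : flipPt ε (n + shiftPt μ ν ε) = n := by
  funext κ
  have h1 := h.1 κ
  have hn1 := hn.1 κ
  simp only [flipPt_apply, Pi.add_apply] at h1 ⊢
  rw [shiftPt_eq_rshift] at h1 ⊢
  rcases Int.units_eq_one_or (ε κ) with e | e
  · rw [e]
    cases role μ ν κ <;> simp [rshift]
  · rw [e] at h1 ⊢
    by_cases hμν : μ = ν
    · have hr : role μ ν κ = Role.gen := by simp [role, hμν]
      rw [hr] at h1 ⊢
      simp only [rshift, Units.val_neg, Units.val_one, neg_mul, one_mul, add_zero] at h1 ⊢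
      omega
    · by_cases hκμ : κ = μ
      · subst hκμ
        have h2 := h.2 hμν
        have hn2 := hn.2 hμν
        simp only [flipPt_apply, Pi.add_apply, shiftPt_eq_rshift, role_mu hμν, e] at h2
        simp only [role_mu hμν, rshift, half_neg_one, Units.val_neg, Units.val_one] at h2 ⊢
        omega
      · by_cases hκν : κ = ν
        · subst hκν
          rw [role_nu hμν] at h1 ⊢
          simp only [rshift, half_neg_one, Units.val_neg, Units.val_one] at h1 ⊢
          omega
        · have hr : role μ ν κ = Role.gen := by simp [role, hμν, hκμ, hκν]
          rw [hr] at h1 ⊢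
          simp only [rshift, Units.val_neg, Units.val_one, neg_mul, one_mul, add_zero] at h1 ⊢
          omega

/-- … and in that case `ε_μ = ε_ν` sign is `+1`: `sgn(ε_μ)sgn(ε_ν) = 1`. [cite: Balaban1987RG1, (5.24) p.294] -/
theorem InOrth.sgn_eq_one {μ ν : Fin d} {n : Pt d} (hn : InOrth μ ν n) (ε : Fin d → ℤˣ)
    (h : InOrth μ ν (flipPt ε (n + shiftPt μ ν ε))) : (sgn (ε μ) : ℂ) * sgn (ε ν) = 1 := by
  by_cases hμν : μ = ν
  · subst hμν; exact sgn_mul_self _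
  · have hμ : ε μ = 1 := by
      rcases Int.units_eq_one_or (ε μ) with e | e
      · exact e
      · exfalso
        have h2 := h.2 hμν
        have hn2 := hn.2 hμν
        simp only [flipPt_apply, Pi.add_apply, shiftPt_eq_rshift, role_mu hμν, e, rshift, half_neg_one,
          Units.val_neg, Units.val_one] at h2
        omega
    have hν : ε ν = 1 := by
      rcases Int.units_eq_one_or (ε ν) with e | e
      · exact e
      · exfalso
        have h1 := h.1 ν
        have hn1 := hn.1 ν
        simp only [flipPt_apply, Pi.add_apply, shiftPt_eq_rshift, role_nu hμν, e, rshift, half_neg_one,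
          Units.val_neg, Units.val_one] at h1
        omega
    rw [hμ, hν, sgn_one, one_mul]

/-- The assembly at a point of the orthant, for a family supported in the orthant: a POSITIVE multiple of the
coefficient there. [cite: Balaban1987RG1, (5.26) p.295] -/
theorem asm_apply_of_inOrth {μ ν : Fin d} {b : Pt d → ℂ} (hb : ∀ n, ¬InOrth μ ν n → b n = 0) {n : Pt d}
    (hn : InOrth μ ν n) : ∃ k : ℕ, 0 < k ∧ asm μ ν b n = k * b n := by
  classical
  let P : (Fin d → ℤˣ) → Prop := fun ε => InOrth μ ν (flipPt ε (n + shiftPt μ ν ε))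
  refine ⟨(Finset.univ.filter P).card, ?_, ?_⟩
  · refine Finset.card_pos.mpr ⟨1, ?_⟩
    simp only [Finset.mem_filter, Finset.mem_univ, true_and, P]
    have : shiftPt μ ν (1 : Fin d → ℤˣ) = 0 := by funext κ; simp [shiftPt]
    simpa [this] using hn
  · have hterm : ∀ ε : Fin d → ℤˣ,
        sgn (ε μ) * sgn (ε ν) * b (flipPt ε (n + shiftPt μ ν ε)) = if P ε then b n else 0 := by
      intro ε
      by_cases hP : P ε
      · rw [if_pos hP, hn.flip_shift_eq ε hP, hn.sgn_eq_one ε hP, one_mul]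
      · rw [if_neg hP, hb _ hP, mul_zero]
    unfold asm
    simp_rw [hterm]
    rw [Finset.sum_ite, Finset.sum_const_zero, add_zero, Finset.sum_const, nsmul_eq_mul]

/-- **Injectivity of the assembly on the printed orthant**: a family supported in the orthant with vanishing assembly
vanishes. [cite: Balaban1987RG1, (5.26) p.295] -/
theorem eq_zero_of_asm_eq_zero {μ ν : Fin d} {b : Pt d → ℂ} (hb : ∀ n, ¬InOrth μ ν n → b n = 0)
    (h : ∀ m, asm μ ν b m = 0) : b = 0 := by
  funext n
  by_cases hn : InOrth μ ν n
  · obtain ⟨k, hk, hkn⟩ := asm_apply_of_inOrth hb hn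
    have := h n
    rw [hkn] at this
    exact (mul_eq_zero.mp this).resolve_left (by exact_mod_cast hk.ne')
  · exact hb n hn

/-- The assembly is additive-linear: `asm(b − b′) = asm b − asm b′`. [cite: Balaban1987RG1, (5.26) p.295] -/
theorem asm_sub (μ ν : Fin d) (b b' : Pt d → ℂ) (m : Pt d) :
    asm μ ν (b - b') m = asm μ ν b m - asm μ ν b' m := by
  unfold asm
  rw [← Finset.sum_sub_distrib]
  exact Finset.sum_congr rfl fun ε _ => by rw [Pi.sub_apply, mul_sub]

/-- **UNIQUENESS OF `g` IN THE REPRESENTATION (5.26)** (p. 294: «It is unique up to an additive constant, and it can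
be made unique requiring some normalization conditions», in `d` variables): if two families of power series
`g_{μν}(w) = Σ_n b_{μν}(n)wⁿ`, `g′` likewise, with `ℓ¹` Taylor coefficients supported in the printed orthant
(`n ≥ 0`; `n_μ ≥ 1` for `μ ≠ ν`), give the same right member of (5.26) on the unit torus, then `b_{μν} = b′_{μν}`
(hence `g_{μν} = g′_{μν}`). [cite: Balaban1987RG1, (5.26) p.295] -/
theorem rep526_unique {μ ν : Fin d} {b b' : Fin d → Fin d → Pt d → ℂ}
    (hb : Summable fun n => ‖b μ ν n‖) (hb' : Summable fun n => ‖b' μ ν n‖)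
    (hbS : ∀ n, ¬InOrth μ ν n → b μ ν n = 0) (hb'S : ∀ n, ¬InOrth μ ν n → b' μ ν n = 0)
    (h : ∀ θ : Fin d → ℝ, rep526 (fun μ ν w => genFun (b μ ν) w) μ ν (torusPt θ)
      = rep526 (fun μ ν w => genFun (b' μ ν) w) μ ν (torusPt θ)) :
    b μ ν = b' μ ν := by
  have hasm : asm μ ν (b μ ν) = asm μ ν (b' μ ν) :=
    eq_of_genFun_torusPt_eq (summable_norm_asm hb μ ν) (summable_norm_asm hb' μ ν) fun θ => by
      rw [← rep526_genFun_torusPt b μ ν hb θ, ← rep526_genFun_torusPt b' μ ν hb' θ, h θ]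
  have hzero : b μ ν - b' μ ν = 0 := by
    refine eq_zero_of_asm_eq_zero (μ := μ) (ν := ν) (fun n hn => ?_) fun m => ?_
    · rw [Pi.sub_apply, hbS n hn, hb'S n hn, sub_zero]
    · rw [asm_sub, hasm, sub_self]
  exact sub_eq_zero.mp hzero

/-! ## §3. The printed EQUIVALENCES for an arbitrary pair `(f, g)` related by (5.26)

With §2, r09's `B12Rep526.eq518_of_eq527` / `eq520_of_eq528` (the directions ⇐) are completed by the directions
⇒: in the class of (5.26)-pairs with `ℓ¹`, orthant-supported Taylor coefficients (the class of the paper's `g`,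
§§3–5), (5.18) for `f` on the unit torus implies (5.27) for `g`, and (5.20) implies (5.28). -/

/-- `rep526` of the permuted family is `rep526` at the permuted point (hypothesis-free companion of
`B12Rep526.eq518_of_eq527`). [cite: Balaban1987RG1, (5.27) p.295] -/
theorem rep526_perm (g : Fin d → Fin d → (Fin d → ℂ) → ℂ) (r : Equiv.Perm (Fin d)) (μ ν : Fin d)
    (z : Fin d → ℂ) :
    rep526 (fun μ' ν' w => g (r μ') (r ν') (permZ r w)) μ ν z = rep526 g (r μ) (r ν) (permZ r z) := by
  unfold rep526
  refine Fintype.sum_equiv (Equiv.arrowCongr r (Equiv.refl ℤˣ)) _ _ fun ε => ?_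
  have hε : (Equiv.arrowCongr r (Equiv.refl ℤˣ)) ε = ε ∘ r.symm := by
    funext κ; simp [Equiv.arrowCongr_apply]
  have hc : (ε ∘ ⇑r.symm) ∘ ⇑r = ε := by funext κ; simp
  rw [hε, twist_permZ, hc]
  simp [permZ]

/-- The orthant is permutation-covariant. [cite: Balaban1987RG1, (5.27) p.295] -/
theorem inOrth_perm (r : Equiv.Perm (Fin d)) (μ ν : Fin d) (m : Pt d) :
    InOrth (r μ) (r ν) (m ∘ r.symm) ↔ InOrth μ ν m := by
  unfold InOrth
  have h1 : (∀ κ, 0 ≤ (m ∘ ⇑r.symm) κ) ↔ ∀ κ, 0 ≤ m κ :=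
    ⟨fun h κ => by simpa using h (r κ), fun h κ => h _⟩
  have h2 : (r μ ≠ r ν → 1 ≤ (m ∘ ⇑r.symm) (r μ)) ↔ (μ ≠ ν → 1 ≤ m μ) := by
    rw [r.injective.ne_iff, Function.comp_apply, Equiv.symm_apply_apply]
  exact and_congr h1 h2

/-- The Laurent series of the permuted coefficient family is the series at the permuted point.
[cite: Balaban1987RG1, (5.27) p.295] -/
theorem genFun_comp_perm (B : Pt d → ℂ) (r : Equiv.Perm (Fin d)) (w : Fin d → ℂ) :
    genFun (fun m => B (m ∘ r.symm)) w = genFun B (permZ r w) := by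
  unfold genFun
  rw [← (Equiv.arrowCongr r.symm (Equiv.refl ℤ)).tsum_eq (fun m => B (m ∘ ⇑r.symm) * zpowv w m)]
  refine tsum_congr fun n => ?_
  have he : (Equiv.arrowCongr r.symm (Equiv.refl ℤ)) n = n ∘ r := by
    funext κ; simp [Equiv.arrowCongr_apply]
  rw [he, zpowv_permZ]
  have : (n ∘ ⇑r) ∘ ⇑r.symm = n := by funext κ; simp
  rw [this]

/-- **(5.18) ⇒ (5.27) for an ARBITRARY (5.26)-pair** («The equalities (5.18) are equivalent to (5.27)», direction
⇒; ⇐ is `B12Rep526.eq518_of_eq527`): if `f = rep526 g` with `g_{μν}(w) = Σ_n b_{μν}(n)wⁿ`, all `b_{μν}` in `ℓ¹` and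
supported in their orthants, and `f_{μν}(rz) = f_{r⁻¹μ,r⁻¹ν}(z)` on the unit torus for the permutation `r`, then
`b_{rμ,rν}(m∘r⁻¹) = b_{μν}(m)` — i.e. `g_{μν}(rz) = g_{r⁻¹μ,r⁻¹ν}(z)` coefficient-wise (and as functions,
`eq527_of_eq518_fun`). [cite: Balaban1987RG1, (5.27) p.295] -/
theorem eq527_of_eq518 {b : Fin d → Fin d → Pt d → ℂ} (hb : ∀ μ ν, Summable fun n => ‖b μ ν n‖)
    (hbS : ∀ μ ν n, ¬InOrth μ ν n → b μ ν n = 0) (r : Equiv.Perm (Fin d))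
    (h518 : ∀ (μ ν : Fin d) (θ : Fin d → ℝ),
      rep526 (fun μ ν w => genFun (b μ ν) w) μ ν (permZ r (torusPt θ))
        = rep526 (fun μ ν w => genFun (b μ ν) w) (r.symm μ) (r.symm ν) (torusPt θ))
    (μ ν : Fin d) (m : Pt d) : b (r μ) (r ν) (m ∘ r.symm) = b μ ν m := by
  -- the permuted family
  let bt : Fin d → Fin d → Pt d → ℂ := fun μ' ν' m => b (r μ') (r ν') (m ∘ r.symm)
  have he : ∀ n : Pt d, (Equiv.arrowCongr r (Equiv.refl ℤ)) n = n ∘ r.symm := fun n => by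
    funext κ; simp [Equiv.arrowCongr_apply]
  have hbt : Summable fun n => ‖bt μ ν n‖ :=
    ((Equiv.arrowCongr r (Equiv.refl ℤ)).summable_iff.mpr (hb (r μ) (r ν))).congr fun n => by
      rw [Function.comp_apply, he]
  have hbtS : ∀ n, ¬InOrth μ ν n → bt μ ν n = 0 := fun n hn =>
    hbS _ _ _ (mt (inOrth_perm r μ ν n).mp hn)
  have key : ∀ θ : Fin d → ℝ, rep526 (fun μ ν w => genFun (bt μ ν) w) μ ν (torusPt θ)
      = rep526 (fun μ ν w => genFun (b μ ν) w) μ ν (torusPt θ) := by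
    intro θ
    have h1 : rep526 (fun μ ν w => genFun (bt μ ν) w) μ ν (torusPt θ)
        = rep526 (fun μ' ν' w => genFun (b (r μ') (r ν')) (permZ r w)) μ ν (torusPt θ) := by
      congr 1
      funext μ' ν' w
      exact genFun_comp_perm (b (r μ') (r ν')) r w
    rw [h1, rep526_perm (fun μ ν w => genFun (b μ ν) w) r μ ν (torusPt θ), h518 (r μ) (r ν) θ]
    simp
  have := rep526_unique hbt (hb μ ν) hbtS (hbS μ ν) key
  exact congrFun this m

/-- `rep526` of the family `w_ν⁻¹ w_μ g_{νμ}(w)` is `rep526 g` with the indices swapped at `z⁻¹`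
(hypothesis-free companion of `B12Rep526.eq520_of_eq528`), at points with non-zero coordinates.
[cite: Balaban1987RG1, (5.28) p.295] -/
theorem rep526_swap_inv (g : Fin d → Fin d → (Fin d → ℂ) → ℂ) (μ ν : Fin d) {z : Fin d → ℂ}
    (hz : ∀ κ, z κ ≠ 0) :
    rep526 (fun μ' ν' w => (w ν')⁻¹ * w μ' * g ν' μ' w) μ ν z = rep526 g ν μ (fun κ => (z κ)⁻¹) := by
  unfold rep526
  rw [← twist_neg_one z]
  refine Fintype.sum_equiv (Equiv.neg (Fin d → ℤˣ)) _ _ fun ε => ?_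
  have h1 : twist (-ε) (twist (-1) z) = twist ε z := by
    rw [twist_twist]; congr 1; simp
  have h2 : ∀ κ, twist (-1 : Fin d → ℤˣ) z κ = (z κ)⁻¹ := fun κ => by simp [twist]
  rw [show (Equiv.neg (Fin d → ℤˣ)) ε = -ε from rfl, h1, h2 μ, h2 ν]
  simp only [Pi.neg_apply, sgn_neg, neg_mul, mul_neg, neg_neg]
  have hμ : low (ε μ) (z μ) * twist ε z μ = (low (-ε μ) (z μ)⁻¹)⁻¹ := key_mu' (ε μ) (hz μ)
  have hν : (low (ε ν) (z ν))⁻¹ * (twist ε z ν)⁻¹ = low (-ε ν) (z ν)⁻¹ := key_nu' (ε ν) (hz ν)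
  rw [← hν, ← hμ]
  ring

/-- The Laurent series of the shifted, swapped coefficient family `m ↦ b_{νμ}(m + e_ν − e_μ)` is
`w_ν⁻¹ w_μ g_{νμ}(w)` at points with non-zero coordinates. [cite: Balaban1987RG1, (5.28) p.295] -/
theorem genFun_shift_swap (B : Pt d → ℂ) (μ ν : Fin d) {w : Fin d → ℂ} (hw : ∀ κ, w κ ≠ 0) :
    genFun (fun m => B (m + (unitVec ν - unitVec μ))) w = (w ν)⁻¹ * w μ * genFun B w := by
  unfold genFun
  rw [← tsum_mul_left, ← (Equiv.addRight (unitVec ν - unitVec μ)).tsum_eq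
    (fun n => (w ν)⁻¹ * w μ * (B n * zpowv w n))]
  refine tsum_congr fun m => ?_
  rw [Equiv.coe_addRight, zpowv_add hw, zpowv_unitVec_sub hw]
  have hμ0 : w μ ≠ 0 := hw μ
  have hν0 : w ν ≠ 0 := hw ν
  field_simp

/-- The orthant of the pair `(ν, μ)` shifted by `e_μ − e_ν` is the orthant of `(μ, ν)` (for `μ ≠ ν`).
[cite: Balaban1987RG1, (5.28) p.295] -/
theorem inOrth_swap_shift {μ ν : Fin d} (hμν : μ ≠ ν) (m : Pt d) :
    InOrth ν μ (m + (unitVec ν - unitVec μ)) ↔ InOrth μ ν m := by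
  have hvμ : (m + (unitVec ν - unitVec μ)) μ = m μ - 1 := by
    show m μ + ((if μ = ν then (1 : ℤ) else 0) - (if μ = μ then (1 : ℤ) else 0)) = m μ - 1
    rw [if_neg hμν, if_pos rfl]; ring
  have hvν : (m + (unitVec ν - unitVec μ)) ν = m ν + 1 := by
    show m ν + ((if ν = ν then (1 : ℤ) else 0) - (if ν = μ then (1 : ℤ) else 0)) = m ν + 1
    rw [if_neg (Ne.symm hμν), if_pos rfl]; ring
  have hvκ : ∀ κ, κ ≠ μ → κ ≠ ν → (m + (unitVec ν - unitVec μ)) κ = m κ := fun κ hκμ hκν => by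
    show m κ + ((if κ = ν then (1 : ℤ) else 0) - (if κ = μ then (1 : ℤ) else 0)) = m κ
    rw [if_neg hκμ, if_neg hκν]; ring
  unfold InOrth
  constructor
  · rintro ⟨h1, h2⟩
    have h2' := h2 (Ne.symm hμν)
    rw [hvν] at h2'
    have hμ' := h1 μ
    rw [hvμ] at hμ'
    refine ⟨fun κ => ?_, fun _ => by omega⟩
    by_cases hκμ : κ = μ
    · rw [hκμ]; omega
    · by_cases hκν : κ = ν
      · rw [hκν]; omega
      · have := h1 κ
        rwa [hvκ κ hκμ hκν] at this
  · rintro ⟨h1, h2⟩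
    have h2' := h2 hμν
    have hν' := h1 ν
    refine ⟨fun κ => ?_, fun _ => by rw [hvν]; omega⟩
    by_cases hκμ : κ = μ
    · rw [hκμ, hvμ]; omega
    · by_cases hκν : κ = ν
      · rw [hκν, hvν]; omega
      · rw [hvκ κ hκμ hκν]; exact h1 κ

/-- **(5.20) ⇒ (5.28) for an ARBITRARY (5.26)-pair** («The equalities (5.20) are equivalent to (5.28)», direction ⇒;
⇐ is `B12Rep526.eq520_of_eq528`): if `f = rep526 g` with `g` as in `rep526_unique` (all pairs), `μ ≠ ν`, and
`f_{μν}(z) = f_{νμ}(z⁻¹)` on the unit torus, then `b_{νμ}(m + e_ν − e_μ) = b_{μν}(m)` — i.e.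
`g_{μν}(z) = z_ν⁻¹z_μ g_{νμ}(z)` coefficient-wise. [cite: Balaban1987RG1, (5.28) p.295] -/
theorem eq528_of_eq520 {b : Fin d → Fin d → Pt d → ℂ} (hb : ∀ μ ν, Summable fun n => ‖b μ ν n‖)
    (hbS : ∀ μ ν n, ¬InOrth μ ν n → b μ ν n = 0) {μ ν : Fin d} (hμν : μ ≠ ν)
    (h520 : ∀ θ : Fin d → ℝ,
      rep526 (fun μ ν w => genFun (b μ ν) w) μ ν (torusPt θ)
        = rep526 (fun μ ν w => genFun (b μ ν) w) ν μ (fun κ => (torusPt θ κ)⁻¹))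
    (m : Pt d) : b ν μ (m + (unitVec ν - unitVec μ)) = b μ ν m := by
  have hbt : Summable fun n => ‖b ν μ (n + (unitVec ν - unitVec μ))‖ :=
    ((Equiv.addRight (unitVec ν - unitVec μ)).summable_iff.mpr (hb ν μ)).congr fun n => rfl
  have hbtS : ∀ n, ¬InOrth μ ν n → b ν μ (n + (unitVec ν - unitVec μ)) = 0 := fun n hn =>
    hbS _ _ _ (mt (inOrth_swap_shift hμν n).mp hn)
  have key : ∀ θ : Fin d → ℝ,
      rep526 (fun μ' ν' w => genFun (fun m => b ν' μ' (m + (unitVec ν' - unitVec μ'))) w) μ ν (torusPt θ)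
        = rep526 (fun μ ν w => genFun (b μ ν) w) μ ν (torusPt θ) := by
    intro θ
    have hz := torusPt_ne_zero θ
    have h1 : rep526 (fun μ' ν' w => genFun (fun m => b ν' μ' (m + (unitVec ν' - unitVec μ'))) w) μ ν (torusPt θ)
        = rep526 (fun μ' ν' w => (w ν')⁻¹ * w μ' * genFun (b ν' μ') w) μ ν (torusPt θ) := by
      unfold rep526
      refine Finset.sum_congr rfl fun ε _ => ?_
      have htw : ∀ κ, twist ε (torusPt θ) κ ≠ 0 := fun κ => zpow_ne_zero _ (hz κ)
      beta_reduce
      rw [genFun_shift_swap (b ν μ) μ ν htw]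
    rw [h1, rep526_swap_inv _ μ ν hz, ← h520 θ]
  have := rep526_unique (b := fun μ' ν' m => b ν' μ' (m + (unitVec ν' - unitVec μ'))) (b' := b)
    hbt (hb μ ν) hbtS (hbS μ ν) key
  exact congrFun this m

end

end Literature.MathematicalPhysics.QuantumFieldTheory.Balaban1983to89.B12Rep526Unique
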